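import Summits.ResolutionOfSingularities.ResolutionOfSingularities.Theorems.PurelyInseparableDim4PureLeafUnitOddAll
import Summits.ResolutionOfSingularities.ResolutionOfSingularities.Theorems.PurelyInseparableDim4PureLeafUnitPthPower
import HarnessLib
import HarnessLib.Audit.Tags

/-!
# Purely inseparable fourfolds — CAPSTONE: every unit leaf `x^a·(1+x_j)` with AT MOST ONE odd partner exponent is an A-WIN of the plain game over `𝔽₂` ‖ K
# (cell res-dim4-pi; brick (δ) «unit leaves x^a(1+x_j)», the UNIFORM theorems assembled) [OURS · counted 0 · a theorem about OUR coordinate-centre frame v4, not about resolution]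

Width seat `res-dim4-p-10` (g6).  The lineage's three uniform (every-size) theorems on the unit leaves `x^a·(1+x_j)`,
`a : Fin 4 → ℕ`, of the plain coordinate game `StateWins 2` over `𝔽₂`, assembled into ONE statement — cited, not restated:

* `a_j` EVEN — `PureLeafNF.stateWins_unitLeaf_even` (`…PureLeafUnitEven`, p702830);
* `a_j` odd, EVERY other exponent even — `PureLeafNF.stateWins_unitLeaf_odd_of_forall_even` (`…PureLeafUnitPthPower`, p703461);
* `a_j` odd, EXACTLY ONE other exponent odd — `PureLeafNF.stateWins_unitLeaf_oddOdd_partner` (`…PureLeafUnitOddAll`, this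
  generation; it subsumes `a_j ∈ {1, 3}` of `…PureLeafUnitOddPair(Rename)` p727028/p727199 and `…PureLeafUnitOddThree` p727909).

**`stateWins_unitLeaf_of_oddPartners_le_one`**: for every unit variable `x_j`, every `a` with at most one odd exponent among the
partners `{a_i : i ≠ j}` (hypothesis form: an odd partner forces the two others even; card form `…_card`), and every booking,
`StateWins 2 ⟨x^a·(1+x_j), r, exc⟩`.  (For `j ≠ 0` by the `S₄`-symmetry `PureLeafGlobalWin.stateWins_rename` from the `x₀`
statement `…₀`.)  So the unit leaves WITHOUT a uniform theorem are exactly «`a_j` odd with ≥ 2 odd partners» — the pattern of the 23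
plain-undecided census leaves (`UnitLeafPlain.plainOpen23`), which also contains certificate-only wins (1111, 3111, 1123, …).

Riders: `𝔽₂`-rational replies; the PLAIN coordinate game of OUR frame v4 (`StateWins 2`), not MODE 1h, not CJS; nothing here proves
F4-C(2,2), `Terminates1h 2 2` or resolution of singularities in dimension ≥ 4 / characteristic `p`; counted 0; AI kernel work, weaker
than expert review. bears_on: LADDER-RESOLUTION:D157-DOOR2 (res-dim4-pi · brick (δ) · unit-leaf row, uniform theorems).
Supports stmt-ResolutionOfSingularities-16155 (helper).
-/

set_option linter.dupNamespace false

open MvPolynomial Finset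

noncomputable section

namespace Summit.ResolutionOfSingularities.ResolutionOfSingularities.Theorems.PIDim4

namespace PureLeafNF

open Literature.AlgebraicGeometry.Resolution

/-- **CAPSTONE, unit variable `x₀`.** If at most one partner exponent `a_k` (`k ≠ 0`) is odd — an odd partner forces the other two
partners even — then the unit leaf `x^a·(1+x₀)` is an A-WIN of the plain game over `𝔽₂`, every booking. [OURS · counted 0 · ‖ K]
[folklore] -/
theorem stateWins_unitLeaf_of_oddPartners_le_one₀ (a : Fin 4 → ℕ)
    (hone : ∀ k, k ≠ 0 → a k % 2 = 1 → ∀ i, i ≠ 0 → i ≠ k → a i % 2 = 0)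
    (r : Fin 4 →₀ ℕ) (exc : Finset (Fin 4)) :
    StateWins 2 (⟨monomial (Finsupp.equivFunOnFinite.symm a) 1 * (1 + X 0), r, exc⟩ : State (ZMod 2)) := by
  by_cases h0 : a 0 % 2 = 0
  · exact stateWins_unitLeaf_even 0 a h0 r exc
  by_cases hex : ∃ k, k ≠ 0 ∧ a k % 2 = 1
  · obtain ⟨k, hk, hk1⟩ := hex
    exact stateWins_unitLeaf_oddOdd_partner k hk a (by omega) hk1 (hone k hk hk1) r exc
  · push Not at hex
    exact stateWins_unitLeaf_odd_of_forall_even 0 a (by omega) (fun k hk => by have := hex k hk; omega) r exc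

/-- **CAPSTONE, any unit variable `x_j`.** If at most one partner exponent `a_k` (`k ≠ j`) is odd, the unit leaf `x^a·(1+x_j)` is
an A-WIN of the plain game over `𝔽₂`, every booking (transport of `…₀` along the renaming `x₀ ↔ x_j`). [OURS · counted 0 · ‖ K]
[folklore] -/
theorem stateWins_unitLeaf_of_oddPartners_le_one (j : Fin 4) (a : Fin 4 → ℕ)
    (hone : ∀ k, k ≠ j → a k % 2 = 1 → ∀ i, i ≠ j → i ≠ k → a i % 2 = 0)
    (r : Fin 4 →₀ ℕ) (exc : Finset (Fin 4)) :
    StateWins 2 (⟨monomial (Finsupp.equivFunOnFinite.symm a) 1 * (1 + X j), r, exc⟩ : State (ZMod 2)) := by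
  set e : Equiv.Perm (Fin 4) := Equiv.swap 0 j with he
  have he0 : e 0 = j := Equiv.swap_apply_left 0 j
  have h' := stateWins_unitLeaf_of_oddPartners_le_one₀ (fun i => a (e i)) (by
      intro k hk hk1 i hi hik
      exact hone (e k) (fun h => hk (e.injective (h.trans he0.symm))) hk1 (e i)
        (fun h => hi (e.injective (h.trans he0.symm))) (fun h => hik (e.injective h))) r exc
  have hren := WinCertF.stateWins_rebook (PureLeafGlobalWin.stateWins_rename e 2 h') r exc
  have hd : Finsupp.mapDomain (⇑e) (Finsupp.equivFunOnFinite.symm fun i => a (e i)) = Finsupp.equivFunOnFinite.symm a := by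
    ext i
    rw [Finsupp.mapDomain_equiv_apply]
    simp
  have hF : (State.rename e (⟨monomial (Finsupp.equivFunOnFinite.symm fun i => a (e i)) 1 * (1 + X 0), r, exc⟩ :
      State (ZMod 2))).F = monomial (Finsupp.equivFunOnFinite.symm a) 1 * (1 + X j) := by
    show rename e (monomial (Finsupp.equivFunOnFinite.symm fun i => a (e i)) 1 * (1 + X 0) : MvPolynomial (Fin 4) (ZMod 2)) = _
    rw [map_mul, rename_monomial, hd, map_add, map_one (rename (⇑e)), rename_X, he0]
  rw [hF] at hren
  exact hren

/-- **CAPSTONE, card form.** If `#{i ≠ j : a_i odd} ≤ 1` then the unit leaf `x^a·(1+x_j)` is an A-WIN of the plain game over `𝔽₂`,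
every booking. [OURS · counted 0 · ‖ K] [folklore] -/
theorem stateWins_unitLeaf_of_oddPartners_card_le_one (j : Fin 4) (a : Fin 4 → ℕ)
    (hcard : ((Finset.univ.erase j).filter fun i => a i % 2 = 1).card ≤ 1)
    (r : Fin 4 →₀ ℕ) (exc : Finset (Fin 4)) :
    StateWins 2 (⟨monomial (Finsupp.equivFunOnFinite.symm a) 1 * (1 + X j), r, exc⟩ : State (ZMod 2)) := by
  refine stateWins_unitLeaf_of_oddPartners_le_one j a (fun k hk hk1 i hi hik => ?_) r exc
  by_contra hodd
  have hi1 : a i % 2 = 1 := by omega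
  have hlt : 1 < ((Finset.univ.erase j).filter fun i => a i % 2 = 1).card :=
    Finset.one_lt_card_iff.mpr ⟨k, i, by simp [hk, hk1], by simp [hi, hi1], fun h => hik h.symm⟩
  omega

end PureLeafNF

end Summit.ResolutionOfSingularities.ResolutionOfSingularities.Theorems.PIDim4

end
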